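import Literature.NumberTheory.Automorphic.TwistedQuotientConeDescentStep
import Summits.Langlands.Langlands.Theorems.IrreducibilityBySelfDualityHeckeEigenvalueFieldStubConeOpEquiv
import HarnessLib

/-!
# Crux `HeckeEigenvalueField` (stmt-Langlands-13632), line `Sketch` — the staircase IV: the tower
# `κ⁽ᵖ⁾ = stair p` (concentration, smoothness, equivariance on `X`, `dκ⁽ᵖ⁺¹⁾ = δκ⁽ᵖ⁾`, constancy of the
# bottom)

Namespace `Summit.Langlands.Langlands.Theorems.HeckeEigenvalueField.Res` (the generic vocabulary of
`Literature/NumberTheory/Automorphic/TwistedQuotientConeDescent{,Rows,Step}.lean` is opened).  Theorems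
only; `--supports` helpers of the registered stub `stub_coneClass_ne_zero` (the (c') programme: Borel's
injectivity by self-regularisation).  This file lives under `Summits` because the equivariance of the
column homotopy uses the landed line stub `stub_coneOperator_comp_clm` (`…StubConeOpEquiv.lean`).

* `stair_apply_eq_zero` — concentration: for `ω` in degree `q + 1` only, `stair p` lives in degree `q - p`;
* `smoothOn_stair` — every `stair p` is `C^∞` on the open convex `X`;
* `isEquivariantOn_cochK`, `isEquivariantOn_stair` — the radial homotopy operator centred at the last
  vertex preserves equivariance on `X`, hence so does the tower, for `ω` invariant on `X`;
* `cochD_stair_zero`, `cochD_delta_stair`, `cochD_stair_succ` — `dκ⁽⁰⁾ = ω`, `d δκ⁽ᵖ⁾ = 0`,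
  `dκ⁽ᵖ⁺¹⁾ = δκ⁽ᵖ⁾` on `X` in positive degrees (homotopy formula on star-shaped opens, `dδ = δd`, `δδ = 0`);
* `delta_stair_zero_eq` — the degree-`0` part of `δκ⁽q⁾` is constant on `X` (equal to its value at the
  last vertex, which `stub_delta_stair_bottom` identifies with `±` the cone cocycle).

[cite: BottTu1982Forms, §I.4 and §II.9] [cite: Dupont1976, §1–2]
-/

set_option linter.dupNamespace false -- project-wide: `Summit.Langlands.Langlands` is the mandated namespace

noncomputable section

open CategoryTheory Set MeasureTheory
open Literature.Analysis.Calculus Literature.Geometry.Kaehler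
open Literature.NumberTheory.Automorphic Literature.NumberTheory.Automorphic.TwistedQuotient

namespace Summit.Langlands.Langlands.Theorems.HeckeEigenvalueField.Res

variable {Γ 𝒢 : Type} [Group Γ] [Group 𝒢] (ι : Γ →* 𝒢) (L : Subgroup 𝒢)
  {V : Type} [NormedAddCommGroup V] [NormedSpace ℂ V]
  (ρ : Representation ℂ Γ V)
  {W : Type} [NormedAddCommGroup W] [NormedSpace ℝ W]
  (a : Γ →* (W →L[ℝ] W))

section Tower


open Filter Topology
open scoped ContDiff Topology

variable {X : Set W} {x₀ : W} [CompleteSpace V]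

omit [CompleteSpace V] in
/-- **Concentration**: if `om` lives in degree `q + 1` only, `stair p` lives in degree `q - p` only
(`r + p ≠ q ⇒ (stair p) g c r = 0`). [folklore] -/
theorem stair_apply_eq_zero {q : ℕ} (om : TFam L W V) (hω : ∀ (c : 𝒢 ⧸ L) (r : ℕ), r ≠ q + 1 → om c r = 0) :
    ∀ (p : ℕ) (g : Fin (p + 1) → Γ) (c : 𝒢 ⧸ L) (r : ℕ), r + p ≠ q → stair L a om x₀ p g c r = 0 := by
  intro p
  induction p with
  | zero =>
    intro g c r hr
    rw [stair_zero, cochK_apply, famK_apply, hω c (r + 1) (by omega)]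
    exact coneOperator_zero _
  | succ p ih =>
    intro g c r hr
    rw [stair_succ, cochK_apply, famK_apply]
    have h0 : delta L (stair L a om x₀ p) g c (r + 1) = 0 := by
      funext x
      rw [delta_apply]
      simp only [Finset.sum_apply, Pi.smul_apply]
      refine Finset.sum_eq_zero fun i _ => ?_
      rw [ih _ c (r + 1) (by omega)]
      simp
    rw [h0]
    exact coneOperator_zero _

variable [FiniteDimensional ℝ W]

omit [CompleteSpace V] in
/-- **Smoothness of the tower**: every `stair p` is `C^∞` on the open convex `X` (the radial homotopy
operator preserves smoothness on sets star-shaped at its centre). [cite: BottTu1982Forms, §I.4] -/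
theorem smoothOn_stair (hXo : IsOpen X) (hXc : Convex ℝ X) (hmaps : ∀ γ : Γ, MapsTo (a γ) X X)
    (hx₀ : x₀ ∈ X) (om : TFam L W V) (hωs : ∀ (c : 𝒢 ⧸ L) (r : ℕ), ContDiffOn ℝ ∞ (om c r) X) :
    ∀ p : ℕ, SmoothOn L X (stair L a om x₀ p) := by
  intro p
  induction p with
  | zero =>
    intro g c r
    rw [stair_zero, cochK_apply, famK_apply]
    exact contDiffOn_coneOperator hXo (hXc.starConvex (hmaps _ hx₀)) (hωs c (r + 1))
  | succ p ih =>
    intro g c r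
    rw [stair_succ, cochK_apply, famK_apply]
    exact contDiffOn_coneOperator hXo (hXc.starConvex (hmaps _ hx₀)) (smoothOn_delta L ih g c (r + 1))

variable [FiniteDimensional ℂ V]

omit [FiniteDimensional ℝ W] in
/-- **The column homotopy preserves equivariance on `X`** (the radial homotopy operator commutes with
linear maps on the nose, `stub_coneOperator_comp_clm`, centred at the last vertex).
[cite: Dupont1976, §1–2] -/
theorem isEquivariantOn_cochK (hXc : Convex ℝ X) (hmaps : ∀ γ : Γ, MapsTo (a γ) X X) (hx₀ : x₀ ∈ X)
    {p : ℕ} {φ : Coch Γ L W V p} (hφ : IsEquivariantOn ι L ρ (a := a) X φ)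
    (hφc : ∀ (g : Fin (p + 1) → Γ) (c : 𝒢 ⧸ L) (r : ℕ), ContinuousOn (φ g c r) X) :
    IsEquivariantOn ι L ρ (a := a) X (cochK L a x₀ φ) := by
  intro γ g c r x hx
  rw [cochK_apply, famK_apply, famAct_eq_actAlt, cochK_apply, famK_apply]
  set A : W →L[ℝ] W := a γ⁻¹ with hA
  set c' : 𝒢 ⧸ L := (ι γ)⁻¹ • c with hc'
  set y : W := a (g (Fin.last p)) x₀ with hy
  have hy' : a ((fun i => γ * g i) (Fin.last p)) x₀ = a γ y := by simp [hy, map_mul]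
  have hAy : A (a γ y) = y := act_inv_apply a γ y
  -- the relation on `X`: `(φ g c' (r+1) (A z)).compCLM A = ρ(γ⁻¹) ∘ φ (γ g) c (r+1) z`
  have hrel : ∀ z ∈ X, (φ g c' (r + 1) (A z)).compContinuousLinearMap A =
      (ρCLM ρ γ⁻¹).compContinuousAlternatingMap (φ (fun i => γ * g i) c (r + 1) z) := by
    intro z hz
    rw [hφ γ g c (r + 1) z hz, famAct_eq_actAlt]
    ext v
    simp [actAlt_apply, hA, hc', Function.comp_def]
  have hcont : ContinuousOn (fun z => φ g c' (r + 1) (A z)) X :=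
    (hφc g c' (r + 1)).comp A.continuous.continuousOn fun z hz => hmaps γ⁻¹ hz
  have hst : StarConvex ℝ (a γ y) X := hXc.starConvex (by rw [← hy']; exact hmaps _ hx₀)
  have key := stub_coneOperator_comp_clm
    A (ρCLM ρ γ⁻¹) hst (φ g c' (r + 1)) (φ (fun i => γ * g i) c (r + 1)) hcont (hφc _ c (r + 1)) hrel hx
  rw [hAy] at key
  -- apply `ρ(γ)` to both sides of `key`
  rw [hy']
  ext v
  have := congrArg (fun M : W [⋀^Fin r]→L[ℝ] V => ρ γ (M v)) key
  simp only [ContinuousAlternatingMap.compContinuousLinearMap_apply,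
    ContinuousLinearMap.compContinuousAlternatingMap_coe, Function.comp_apply, ρCLM_apply,
    coeff_apply_inv] at this
  rw [actAlt_apply]
  exact this.symm

/-- **Equivariance of the tower** for a family `om` invariant and continuous on `X`.
[cite: Dupont1976, §1–2] -/
theorem isEquivariantOn_stair (hXo : IsOpen X) (hXc : Convex ℝ X) (hmaps : ∀ γ : Γ, MapsTo (a γ) X X)
    (hx₀ : x₀ ∈ X) (om : TFam L W V) (hωs : ∀ (c : 𝒢 ⧸ L) (r : ℕ), ContDiffOn ℝ ∞ (om c r) X)
    (hωinv : ∀ (γ : Γ) (c : 𝒢 ⧸ L) (r : ℕ), ∀ x ∈ X, om c r x = famAct ι L ρ a γ om c r x) :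
    ∀ p : ℕ, IsEquivariantOn ι L ρ (a := a) X (stair L a om x₀ p) := by
  intro p
  induction p with
  | zero =>
    rw [stair_zero]
    exact isEquivariantOn_cochK ι L ρ a hXc hmaps hx₀ (fun γ g c r x hx => hωinv γ c r x hx)
      fun g c r => (hωs c r).continuousOn
  | succ p ih =>
    rw [stair_succ]
    refine isEquivariantOn_cochK ι L ρ a hXc hmaps hx₀ (isEquivariantOn_delta ι L ρ a ih) fun g c r => ?_
    exact (smoothOn_delta L (smoothOn_stair L a hXo hXc hmaps hx₀ om hωs p) g c r).continuousOn

omit [FiniteDimensional ℂ V] in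
/-- **`dκ⁽⁰⁾ = ω` on `X` in positive degrees** (homotopy formula for the radial operator on the
star-shaped `X`, `ω` closed on `X`). [cite: BottTu1982Forms, §I.4] -/
theorem cochD_stair_zero (hXo : IsOpen X) (hXc : Convex ℝ X) (hmaps : ∀ γ : Γ, MapsTo (a γ) X X)
    (hx₀ : x₀ ∈ X) (om : TFam L W V) (hωs : ∀ (c : 𝒢 ⧸ L) (r : ℕ), ContDiffOn ℝ ∞ (om c r) X)
    (hωd : ∀ (c : 𝒢 ⧸ L) (r : ℕ), ∀ x ∈ X, extDeriv (om c r) x = 0)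
    (g : Fin 1 → Γ) (c : 𝒢 ⧸ L) (r : ℕ) {x : W} (hx : x ∈ X) :
    cochD L (stair L a om x₀ 0) g c (r + 1) x = om c (r + 1) x := by
  rw [cochD_apply, famD_succ, stair_zero, cochK_apply, famK_apply]
  exact extDeriv_coneOperator_of_extDeriv_eq_zero hXo (hXc.starConvex (hmaps _ hx₀)) (hωs c (r + 1))
    (hωd c (r + 1)) hx

omit [FiniteDimensional ℂ V] in
/-- `dκ⁽ᵖ⁺¹⁾ = δκ⁽ᵖ⁾` on `X` in positive degrees, GIVEN that `δκ⁽ᵖ⁾` is closed on `X` in positive degrees.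
[cite: BottTu1982Forms, §I.4] -/
theorem cochD_stair_succ_of (hXo : IsOpen X) (hXc : Convex ℝ X) (hmaps : ∀ γ : Γ, MapsTo (a γ) X X)
    (hx₀ : x₀ ∈ X) (om : TFam L W V) (hωs : ∀ (c : 𝒢 ⧸ L) (r : ℕ), ContDiffOn ℝ ∞ (om c r) X) (p : ℕ)
    (hA : ∀ (g : Fin (p + 2) → Γ) (c : 𝒢 ⧸ L) (r : ℕ), ∀ x ∈ X,
      cochD L (delta L (stair L a om x₀ p)) g c (r + 1) x = 0)
    (g : Fin (p + 2) → Γ) (c : 𝒢 ⧸ L) (r : ℕ) {x : W} (hx : x ∈ X) :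
    cochD L (stair L a om x₀ (p + 1)) g c (r + 1) x = delta L (stair L a om x₀ p) g c (r + 1) x := by
  rw [cochD_apply, famD_succ, stair_succ, cochK_apply, famK_apply]
  refine extDeriv_coneOperator_of_extDeriv_eq_zero hXo (hXc.starConvex (hmaps _ hx₀))
    (smoothOn_delta L (smoothOn_stair L a hXo hXc hmaps hx₀ om hωs p) g c (r + 1)) (fun z hz => ?_) hx
  have := hA g c (r + 1) z hz
  rwa [cochD_apply, famD_succ] at this

omit [FiniteDimensional ℂ V] in
/-- **The inputs of the homotopy operator are closed**: `d δκ⁽ᵖ⁾ = 0` on `X` in positive degrees, for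
every `p` (`dδ = δd`, the tower relation at level `p`, and `δ(const ω) = 0` over two vertices resp.
`δδ = 0`). [cite: BottTu1982Forms, §II.9] -/
theorem cochD_delta_stair (hXo : IsOpen X) (hXc : Convex ℝ X) (hmaps : ∀ γ : Γ, MapsTo (a γ) X X)
    (hx₀ : x₀ ∈ X) (om : TFam L W V) (hωs : ∀ (c : 𝒢 ⧸ L) (r : ℕ), ContDiffOn ℝ ∞ (om c r) X)
    (hωd : ∀ (c : 𝒢 ⧸ L) (r : ℕ), ∀ x ∈ X, extDeriv (om c r) x = 0) :
    ∀ (p : ℕ) (g : Fin (p + 2) → Γ) (c : 𝒢 ⧸ L) (r : ℕ), ∀ x ∈ X,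
      cochD L (delta L (stair L a om x₀ p)) g c (r + 1) x = 0 := by
  have hsm := smoothOn_stair L a hXo hXc hmaps hx₀ om hωs
  intro p
  induction p with
  | zero =>
    intro g c r x hx
    rw [cochD_delta_apply L _ g c r fun i => ((hsm 0 _ c r).contDiffAt (hXo.mem_nhds hx)).differentiableAt (by simp),
      delta_apply]
    simp only [Finset.sum_apply, Pi.smul_apply, cochD_stair_zero L a hXo hXc hmaps hx₀ om hωs hωd _ c r hx]
    simp [Fin.sum_univ_succ]
  | succ p ih =>
    intro g c r x hx
    rw [cochD_delta_apply L _ g c r fun i => ((hsm (p + 1) _ c r).contDiffAt (hXo.mem_nhds hx)).differentiableAt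
      (by simp), delta_apply]
    simp only [Finset.sum_apply, Pi.smul_apply]
    have hf : ∀ i : Fin (p + 3), cochD L (stair L a om x₀ (p + 1)) (fun j => g (i.succAbove j)) c (r + 1) x =
        delta L (stair L a om x₀ p) (fun j => g (i.succAbove j)) c (r + 1) x :=
      fun i => cochD_stair_succ_of L a hXo hXc hmaps hx₀ om hωs p ih _ c r hx
    simp only [hf]
    have hdd := congrArg (fun φ : TFam L W V => φ c (r + 1) x) (congrFun (delta_delta L (stair L a om x₀ p)) g)
    simp only [delta_apply, Finset.sum_apply, Pi.smul_apply, Pi.zero_apply] at hdd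
    simpa only [delta_apply, Finset.sum_apply, Pi.smul_apply] using hdd

omit [FiniteDimensional ℂ V] in
/-- **The tower relation `dκ⁽ᵖ⁺¹⁾ = δκ⁽ᵖ⁾`** on `X` in positive degrees. [cite: BottTu1982Forms, §II.9] -/
theorem cochD_stair_succ (hXo : IsOpen X) (hXc : Convex ℝ X) (hmaps : ∀ γ : Γ, MapsTo (a γ) X X)
    (hx₀ : x₀ ∈ X) (om : TFam L W V) (hωs : ∀ (c : 𝒢 ⧸ L) (r : ℕ), ContDiffOn ℝ ∞ (om c r) X)
    (hωd : ∀ (c : 𝒢 ⧸ L) (r : ℕ), ∀ x ∈ X, extDeriv (om c r) x = 0) (p : ℕ)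
    (g : Fin (p + 2) → Γ) (c : 𝒢 ⧸ L) (r : ℕ) {x : W} (hx : x ∈ X) :
    cochD L (stair L a om x₀ (p + 1)) g c (r + 1) x = delta L (stair L a om x₀ p) g c (r + 1) x :=
  cochD_stair_succ_of L a hXo hXc hmaps hx₀ om hωs p (cochD_delta_stair L a hXo hXc hmaps hx₀ om hωs hωd p) g c r hx

end Tower

/-- **Stub TOWER-CONST — the bottom of the staircase is locally constant**: the degree-`0` part of
`δκ⁽q⁾` has zero derivative on `X` (tower relations `dκ⁽ᵖ⁺¹⁾ = δκ⁽ᵖ⁾`, `dδ = δd`, `δδ = 0`), hence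
takes at every point of `X` its value at the last vertex `a(g_{q+1}) x₀` (Poincaré lemma in degree `0`
on the star-shaped `X`).  Registered stub of the line `Sketch` (signature verbatim).
[cite: BottTu1982Forms, §I.4 and §II.9] -/
theorem stub_delta_stair_const
    {Γ 𝒢 : Type} [Group Γ] [Group 𝒢] (L : Subgroup 𝒢)
    {V : Type} [NormedAddCommGroup V] [NormedSpace ℂ V]
    {W : Type} [NormedAddCommGroup W] [NormedSpace ℝ W]
    (a : Γ →* (W →L[ℝ] W)) {X : Set W} {x₀ : W} [CompleteSpace V] [FiniteDimensional ℝ W]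
    (hXo : IsOpen X) (hXc : Convex ℝ X) (hmaps : ∀ γ : Γ, Set.MapsTo (a γ) X X)
    (hx₀ : x₀ ∈ X) (om : TwistedQuotient.TFam L W V)
    (hωs : ∀ (c : 𝒢 ⧸ L) (r : ℕ), ContDiffOn ℝ ((⊤ : ℕ∞) : WithTop ℕ∞) (om c r) X)
    (hωd : ∀ (c : 𝒢 ⧸ L) (r : ℕ), ∀ x ∈ X, extDeriv (om c r) x = 0) (q : ℕ)
    (g : Fin (q + 2) → Γ) (c : 𝒢 ⧸ L) {x : W} (hx : x ∈ X) :
    TwistedQuotient.delta L (TwistedQuotient.stair L a om x₀ q) g c 0 x =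
      TwistedQuotient.delta L (TwistedQuotient.stair L a om x₀ q) g c 0 (a (g (Fin.last (q + 1))) x₀) := by
  have hsm := smoothOn_stair L a hXo hXc hmaps hx₀ om hωs
  refine eq_of_extDeriv_eq_zero_of_starConvex hXo (hXc.starConvex (hmaps _ hx₀))
    ((smoothOn_delta L (hsm q) g c 0).differentiableOn (by simp)) (fun z hz => ?_) hx
  have := cochD_delta_stair L a hXo hXc hmaps hx₀ om hωs hωd q g c 0 z hz
  rwa [cochD_apply, famD_succ] at this

end Summit.Langlands.Langlands.Theorems.HeckeEigenvalueField.Res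

end
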